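import Summits.QuantumAdvantage.QuantumAdvantage.Theorems.FanInRootHubDeg

/-!
# FanInRoot (5/11): the even-stretch COLLAPSE, part A — class pointer / offset parity device, local step lemmas, kernel transfer
-/

set_option linter.dupNamespace false -- D-0017: single-problem summit ⇒ `QuantumAdvantage.QuantumAdvantage` by design

namespace Summit.QuantumAdvantage.QuantumAdvantage.Theorems.FanInRoot

open Finset
open Summit.QuantumAdvantage.AdviceFreeQNC0
open Literature.Computability.QuantumComplexity
open Literature.Computability.QuantumComplexity.RingHLF
open Literature.Computability.MetaComplexity
open scoped Classical

/-! ### PROOF OF THE COLLAPSE LAW (`collapseLaw3`), part A: the folding device and the step lemmas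

Bookkeeping device (no sorting, no stretch lists): `A i = #{h ∈ H : h ≤ i}`, class pointer `q i = A i mod k` (index of the NEXT hub), offset parity
`par i = (i + A i) mod 2`; `EvenStretch` says `par` is CONSTANT (`= c`) on hubs; the folded position of `i` is `cls i = prv (q i)` if `par i = c` (even offset:
carries `u_a`) and `q i` otherwise (odd offset: carries `u_{a+1}`).  Two LOCAL STEP LEMMAS (`q`/`par` under `nxt`, wrap-around included) drive everything. -/
namespace Collapse

variable {n : ℕ} (H : Finset (Fin n))

/-- Number of hubs at or before position `i`. -/
def A (i : Fin n) : ℕ := (H.filter fun h => h ≤ i).card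

/-- Offset parity. -/
def par (i : Fin n) : ℕ := (i.val + A H i) % 2

/-- FanInRoot helper `par_lt` (lens-1 g6 FanInRoot package; see the module docstring). -/
theorem par_lt (i : Fin n) : par H i < 2 := Nat.mod_lt _ (by norm_num)

/-- Class pointer: the index (mod `k`) of the next hub at or after… i.e. `A i mod k`. -/
def q (hk : 0 < H.card) (i : Fin n) : Fin H.card := ⟨A H i % H.card, Nat.mod_lt _ hk⟩

/-- Folded position. -/
def cls (hk : 0 < H.card) (c : ℕ) (i : Fin n) : Fin H.card := if par H i = c then prv (q H hk i) else q H hk i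

/-- The 2-periodic extension of a bare-cycle vector `u` to `C_n`. -/
def ext (hk : 0 < H.card) (c : ℕ) (u : Fin H.card → Bool) : Fin n → Bool := fun i => u (cls H hk c i)

/-- FanInRoot helper `A_le_card` (lens-1 g6 FanInRoot package; see the module docstring). -/
theorem A_le_card (i : Fin n) : A H i ≤ H.card := Finset.card_filter_le _ _

/-- FanInRoot helper `A_last` (lens-1 g6 FanInRoot package; see the module docstring). -/
theorem A_last (b : Fin n) (hb : b.val + 1 = n) : A H b = H.card := by
  unfold A; congr 1; apply Finset.filter_true_of_mem; intro h _; exact Fin.le_iff_val_le_val.2 (by omega)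

/-- FanInRoot helper `nxt_val_of_lt` (lens-1 g6 FanInRoot package; see the module docstring). -/
theorem nxt_val_of_lt (b : Fin n) (hb : b.val + 1 < n) : (nxt b).val = b.val + 1 := by
  simp [nxt, Nat.mod_eq_of_lt hb]

/-- FanInRoot helper `nxt_val_of_eq` (lens-1 g6 FanInRoot package; see the module docstring). -/
theorem nxt_val_of_eq (b : Fin n) (hb : b.val + 1 = n) : (nxt b).val = 0 := by
  simp [nxt, hb]

/-- FanInRoot helper `A_nxt_of_lt` (lens-1 g6 FanInRoot package; see the module docstring). -/
theorem A_nxt_of_lt (b : Fin n) (hb : b.val + 1 < n) : A H (nxt b) = A H b + (if nxt b ∈ H then 1 else 0) := by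
  unfold A
  have hv := nxt_val_of_lt b hb
  have hsplit : (H.filter fun h => h ≤ nxt b) = (H.filter fun h => h ≤ b) ∪ (H.filter fun h => h = nxt b) := by
    ext h; simp only [mem_filter, mem_union, Fin.le_iff_val_le_val, Fin.ext_iff, hv]; constructor
    · rintro ⟨hH, hle⟩; by_cases h1 : h.val ≤ b.val
      · exact Or.inl ⟨hH, h1⟩
      · exact Or.inr ⟨hH, by omega⟩
    · rintro (⟨hH, hle⟩ | ⟨hH, heq⟩)
      · exact ⟨hH, by omega⟩
      · exact ⟨hH, by omega⟩
  rw [hsplit, Finset.card_union_of_disjoint]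
  · congr 1
    by_cases hm : nxt b ∈ H
    · rw [if_pos hm]; rw [Finset.card_eq_one]; exact ⟨nxt b, by ext h; simp [mem_filter]; intro hh; exact hh ▸ hm⟩
    · rw [if_neg hm]; rw [Finset.card_eq_zero]; ext h; simp [mem_filter]; intro hH hh; exact hm (hh ▸ hH)
  · rw [Finset.disjoint_left]; intro h h1 h2
    simp only [mem_filter, Fin.le_iff_val_le_val, Fin.ext_iff, hv] at h1 h2; omega

/-- FanInRoot helper `A_nxt_of_eq` (lens-1 g6 FanInRoot package; see the module docstring). -/
theorem A_nxt_of_eq (b : Fin n) (hb : b.val + 1 = n) : A H (nxt b) = (if nxt b ∈ H then 1 else 0) := by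
  unfold A
  have hv := nxt_val_of_eq b hb
  have hfilter : (H.filter fun h => h ≤ nxt b) = (H.filter fun h => h = nxt b) := by
    ext h; simp only [mem_filter, Fin.le_iff_val_le_val, Fin.ext_iff, hv]; constructor
    · rintro ⟨hH, hle⟩; exact ⟨hH, by omega⟩
    · rintro ⟨hH, heq⟩; exact ⟨hH, by omega⟩
  rw [hfilter]
  by_cases hm : nxt b ∈ H
  · rw [if_pos hm, Finset.card_eq_one]; exact ⟨nxt b, by ext h; simp [mem_filter]; intro hh; exact hh ▸ hm⟩
  · rw [if_neg hm, Finset.card_eq_zero]; ext h; simp [mem_filter]; intro hH hh; exact hm (hh ▸ hH)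

/-- STEP LEMMA for the class pointer (wrap-around included). -/
theorem q_nxt (hk : 0 < H.card) (b : Fin n) : q H hk (nxt b) = if nxt b ∈ H then nxt (q H hk b) else q H hk b := by
  have hbn : b.val + 1 ≤ n := b.isLt
  rcases Nat.lt_or_eq_of_le hbn with hlt | heq
  · apply Fin.ext
    by_cases hm : nxt b ∈ H
    · rw [if_pos hm]
      show A H (nxt b) % H.card = (A H b % H.card + 1) % H.card
      rw [A_nxt_of_lt H b hlt, if_pos hm, Nat.add_mod]
      conv_rhs => rw [Nat.add_mod, Nat.mod_mod]
    · rw [if_neg hm]; simp only [q, A_nxt_of_lt H b hlt, if_neg hm, add_zero]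
  · apply Fin.ext
    have hA := A_last H b heq
    by_cases hm : nxt b ∈ H
    · rw [if_pos hm]
      show A H (nxt b) % H.card = (A H b % H.card + 1) % H.card
      rw [A_nxt_of_eq H b heq, if_pos hm, hA, Nat.mod_self, zero_add]
    · rw [if_neg hm]; simp only [q, A_nxt_of_eq H b heq, if_neg hm, hA]; simp

/-- STEP LEMMA for the offset parity (wrap-around uses `n − k` even). -/
theorem par_nxt (hE : H ∈ EvenStretch n) (b : Fin n) : par H (nxt b) = (par H b + 1 + (if nxt b ∈ H then 1 else 0)) % 2 := by
  have hbn : b.val + 1 ≤ n := b.isLt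
  have hkn : H.card ≤ n := by simpa using Finset.card_le_univ H
  rcases Nat.lt_or_eq_of_le hbn with hlt | heq
  · simp only [par, A_nxt_of_lt H b hlt, nxt_val_of_lt b hlt]
    by_cases hm : nxt b ∈ H <;> simp [hm] <;> omega
  · have hA := A_last H b heq
    have h0 := hE.1
    simp only [par, A_nxt_of_eq H b heq, nxt_val_of_eq b heq, hA]
    by_cases hm : nxt b ∈ H <;> simp [hm] <;> omega

/-- FanInRoot helper `q_prv` (lens-1 g6 FanInRoot package; see the module docstring). -/
theorem q_prv (hk : 0 < H.card) (b : Fin n) : q H hk (prv b) = if b ∈ H then prv (q H hk b) else q H hk b := by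
  have h := q_nxt H hk (prv b)
  rw [nxt_prv] at h
  by_cases hm : b ∈ H
  · rw [if_pos hm] at h; rw [if_pos hm, h, prv_nxt]
  · rw [if_neg hm] at h; rw [if_neg hm, h]

/-- FanInRoot helper `par_prv` (lens-1 g6 FanInRoot package; see the module docstring). -/
theorem par_prv (hE : H ∈ EvenStretch n) (b : Fin n) : par H (prv b) = (par H b + 1 + (if b ∈ H then 1 else 0)) % 2 := by
  have h := par_nxt H hE (prv b)
  rw [nxt_prv] at h
  have h1 := par_lt H (prv b)
  have h2 := par_lt H b
  by_cases hm : b ∈ H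
  · rw [if_pos hm] at h ⊢; omega
  · rw [if_neg hm] at h ⊢; omega

/-- `EvenStretch` ⟹ the offset parity is constant on hubs. -/
theorem par_hub_const (hE : H ∈ EvenStretch n) {h h' : Fin n} (hh : h ∈ H) (hh' : h' ∈ H) : par H h = par H h' := by
  have key := hE.2 h hh h' hh'
  have hA : ∀ g ∈ H, A H g = (H.filter fun i => i < g).card + 1 := by
    intro g hg
    unfold A
    have hsplit : (H.filter fun i => i ≤ g) = (H.filter fun i => i < g) ∪ {g} := by
      ext i; simp only [mem_filter, mem_union, mem_singleton]; constructor
      · rintro ⟨hi, hle⟩; rcases lt_or_eq_of_le hle with hlt | heq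
        · exact Or.inl ⟨hi, hlt⟩
        · exact Or.inr heq
      · rintro (⟨hi, hlt⟩ | rfl)
        · exact ⟨hi, le_of_lt hlt⟩
        · exact ⟨hg, le_rfl⟩
    rw [hsplit, Finset.card_union_of_disjoint]
    · simp
    · simp
  simp only [par, hA h hh, hA h' hh']
  omega

/-- Counting transfer along the order isomorphism `Fin k ≃o H`. -/
theorem card_filter_hubs (Q : Fin n → Prop) [DecidablePred Q] :
    (H.filter Q).card = (univ.filter fun a : Fin H.card => Q ((H.orderIsoOfFin rfl) a).1).card := by
  symm
  refine Finset.card_bij (fun a _ => ((H.orderIsoOfFin rfl) a).1) (fun a ha => ?_) (fun a₁ h₁ a₂ h₂ h => ?_) (fun b hb => ?_)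
  · simp only [mem_filter, mem_univ, true_and] at ha; exact mem_filter.2 ⟨((H.orderIsoOfFin rfl) a).2, ha⟩
  · exact (H.orderIsoOfFin rfl).injective (Subtype.ext h)
  · obtain ⟨hbH, hQ⟩ := mem_filter.1 hb
    refine ⟨(H.orderIsoOfFin rfl).symm ⟨b, hbH⟩, ?_, by simp⟩
    simp only [mem_filter, mem_univ, true_and, OrderIso.apply_symm_apply]; exact hQ

/-- RANK LEMMA: the `a`-th hub has exactly `a + 1` hubs at or before it. -/
theorem A_hub (a : Fin H.card) : A H ((H.orderIsoOfFin rfl) a).1 = a.val + 1 := by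
  unfold A
  rw [card_filter_hubs H]
  have : (univ.filter fun a' : Fin H.card => ((H.orderIsoOfFin rfl) a').1 ≤ ((H.orderIsoOfFin rfl) a).1) = Finset.Iic a := by
    ext a'; simp only [mem_filter, mem_univ, true_and, Finset.mem_Iic, Subtype.coe_le_coe, OrderIso.le_iff_le]
  rw [this, Fin.card_Iic]

/-- The link between the order-iso index and the class pointer at a hub. -/
theorem symm_eq_prv_q (hk : 0 < H.card) {b : Fin n} (hb : b ∈ H) : (H.orderIsoOfFin rfl).symm ⟨b, hb⟩ = prv (q H hk b) := by
  set a := (H.orderIsoOfFin rfl).symm ⟨b, hb⟩ with ha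
  have hba : ((H.orderIsoOfFin rfl) a).1 = b := by rw [ha, OrderIso.apply_symm_apply]
  have hA : A H b = a.val + 1 := by rw [← hba]; exact A_hub H a
  have hq : q H hk b = nxt a := by
    apply Fin.ext; simp only [q, hA, nxt]
  rw [hq, prv_nxt]

/-- FanInRoot helper `cls_hub` (lens-1 g6 FanInRoot package; see the module docstring). -/
theorem cls_hub (hk : 0 < H.card) {c : ℕ} (hc : ∀ h ∈ H, par H h = c) {b : Fin n} (hb : b ∈ H) :
    cls H hk c b = prv (q H hk b) := by simp [cls, hc b hb]

/-- FanInRoot helper `cls_prv_hub` (lens-1 g6 FanInRoot package; see the module docstring). -/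
theorem cls_prv_hub (hE : H ∈ EvenStretch n) (hk : 0 < H.card) {c : ℕ} (hc : ∀ h ∈ H, par H h = c) {b : Fin n} (hb : b ∈ H) :
    cls H hk c (prv b) = prv (cls H hk c b) := by
  have hp := par_prv H hE b
  rw [if_pos hb, hc b hb] at hp
  have hcl : c < 2 := by rw [← hc b hb]; exact par_lt H b
  have hpc : par H (prv b) = c := by omega
  rw [cls, if_pos hpc, q_prv, if_pos hb, cls_hub H hk hc hb]

/-- FanInRoot helper `cls_nxt_hub` (lens-1 g6 FanInRoot package; see the module docstring). -/
theorem cls_nxt_hub (hE : H ∈ EvenStretch n) (hk : 0 < H.card) {c : ℕ} (hc : ∀ h ∈ H, par H h = c) {b : Fin n} (hb : b ∈ H) :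
    cls H hk c (nxt b) = nxt (cls H hk c b) := by
  rw [cls_hub H hk hc hb, nxt_prv]
  have hp := par_nxt H hE b
  rw [hc b hb] at hp
  have hcl : c < 2 := by rw [← hc b hb]; exact par_lt H b
  by_cases hm : nxt b ∈ H
  · rw [cls, if_pos (hc _ hm), q_nxt, if_pos hm, prv_nxt]
  · rw [if_neg hm] at hp
    have hpc : par H (nxt b) ≠ c := by omega
    rw [cls, if_neg hpc, q_nxt, if_neg hm]

/-- Off the hubs, the two neighbours fold to the same bare position … -/
theorem cls_prv_eq_cls_nxt (hE : H ∈ EvenStretch n) (hk : 0 < H.card) {c : ℕ} (hc : ∀ h ∈ H, par H h = c) {b : Fin n} (hb : b ∉ H) :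
    cls H hk c (prv b) = cls H hk c (nxt b) := by
  have hpp := par_prv H hE b
  have hpn := par_nxt H hE b
  have hqp := q_prv H hk b
  have hqn := q_nxt H hk b
  rw [if_neg hb] at hpp hqp
  have h2 := par_lt H b
  have h3 := par_lt H (nxt b)
  by_cases hpc : par H b = c
  · -- even offset: both neighbours carry `u_{q b}`
    have hp1 : par H (prv b) ≠ c := by omega
    rw [cls, if_neg hp1, hqp, cls]
    by_cases hm : nxt b ∈ H
    · rw [if_pos hm] at hpn hqn
      have : par H (nxt b) = c := by omega
      rw [if_pos this, hqn, prv_nxt]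
    · rw [if_neg hm] at hpn hqn
      have : par H (nxt b) ≠ c := by omega
      rw [if_neg this, hqn]
  · -- odd offset: both neighbours carry `u_{q b - 1}`; the next position cannot be a hub (that stretch would be odd)
    have hp1 : par H (prv b) = c := by
      have hcl : c < 2 := by
        obtain ⟨h₀, hh₀⟩ : H.Nonempty := Finset.card_pos.1 hk
        rw [← hc h₀ hh₀]; exact par_lt H h₀
      omega
    rw [cls, if_pos hp1, hqp, cls]
    by_cases hm : nxt b ∈ H
    · exfalso; rw [if_pos hm] at hpn; have := hc _ hm; omega
    · rw [if_neg hm] at hpn hqn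
      have : par H (nxt b) = c := by
        have hcl : c < 2 := by rw [← hp1]; exact par_lt H (prv b)
        omega
      rw [if_pos this, hqn]

/-- KERNEL TRANSFER: the 2-periodic extension of a bare kernel vector is a kernel vector of the hub instance. -/
theorem inKernel_ext (hE : H ∈ EvenStretch n) (hk : 0 < H.card) {c : ℕ} (hc : ∀ h ∈ H, par H h = c)
    (β u : Fin H.card → Bool) (hu : InKernel β u) : InKernel (hubInst H β) (ext H hk c u) := by
  intro b
  by_cases hb : b ∈ H
  · have e1 : ext H hk c u (prv b) = u (prv (cls H hk c b)) := by simp only [ext, cls_prv_hub H hE hk hc hb]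
    have e2 : ext H hk c u (nxt b) = u (nxt (cls H hk c b)) := by simp only [ext, cls_nxt_hub H hE hk hc hb]
    have e3 : hubInst H β b = β (cls H hk c b) := by rw [hubInst_mem H β hb, symm_eq_prv_q H hk hb, cls_hub H hk hc hb]
    rw [e1, e2, e3]
    exact hu (cls H hk c b)
  · have e1 : ext H hk c u (prv b) = ext H hk c u (nxt b) := by simp only [ext, cls_prv_eq_cls_nxt H hE hk hc hb]
    have e3 : hubInst H β b = false := by simp [hubInst, hb]
    rw [e1, e3]; simp

end Collapse

end Summit.QuantumAdvantage.QuantumAdvantage.Theorems.FanInRoot
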